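/-
Copyright (c) 2026 the pub-hodgecm-mathlib formalisation cell (harness21).  Prover seat hodgecm-mathlib-K2Liu-p12 (g0): Track B «K2-LIT»,
#184♮ = hLiu418 = stmt-HodgeConjecture-24832; Road Φ of socket #41, organ Φ4 «unramified local coefficient» (LEAD F0P6-plan (g13) ruling «M-157k»), file U1.
-/
import Summits.HodgeConjecture.HodgeConjecture.Theorems.K2LiuBadPlaceWhittakerFarShells   -- ★ F4b-1: tools + the `∃ K₁` version

/-!
# Crux `HLiu418`, Road Φ of socket #41, organ Φ4 — FILE U1: FAR-SHELL VANISHING WITH AN EXPLICIT SUPPLY RADIUS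

Cell `hodgecm-mathlib`, crux item hLiu418 = `stmt-HodgeConjecture-24832`, route of record `HCCMUnconditional`; squad K2 ∕ K2Liu, road `K2_Liu`,
socket #41 `sig_K2LiuSiegelEisensteinContinuation`, Road Φ, organ Φ4 = «(R-bound) + the one exact value» (ruling M-157k; census
`K2/K2Liu-p12/g0/CENSUS-PHI4-UnramifiedLocalCoefficient.K2Liu-p12-g0.md` §1 (U1)).  THEOREMS ONLY (no `def`, no `instance`, no `notation`, no
named-fact hypothesis, no `sorry`); lane `--supports stmt-HodgeConjecture-24832` (count-neutral helper; closes no socket by itself).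

WHY.  ★ F4b-1 `K2LiuBadPlaceWhittakerFarShells.setIntegral_farShell_eq_zero` produces its threshold `K₁` from the Levi-supply radii of ★ F3a
(`exists_ball_levi_supply`, a continuity statement) and the inverse-integrality radii (`eventually_mball_zero_inv_one_add_smul`) by `choose` — so
`K₁` is NOT uniform in the place `v` as typed.  The (R-bound) face of organ Φ4 («`|W°_{β,v}(1,s)| ≤ q_v^{c(1 + ord_v det β)(1+|Re s|)}` with `c`
ABSOLUTE») needs the same vanishing with the supply HYPOTHESISED at given radii: this file proves exactly that, with the explicit threshold
  `k ≥ |jS| + |jI| + |d| + 2|c_ε| + 2|c₂| + 2 + 4b + 2b′`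
(`jS` = radius at which `U` contains the Levi elements `m(1 + ẑu)` for integral directions `u`, with `χ`∕modulus-trivial Weyl conjugates; `jI` = radius of
integrality of `(1 + ẑu)⁻¹` for `u ∈ ball(−2b_T)`; `d` = conductor exponent of `ψ_v`; `c_ε, c₂` = valuations of `2ε, 2`; `b_T` = denominators of `T, T⁻¹`;
`b, b′` = exponents of `β, β⁻¹`).  At an unramified good place `jS = jI = 1`, `d = c_ε = c₂ = b_T = 0` for every `v` at once (file U1′), whence the
ABSOLUTE threshold `k ≥ 4 + 4b + 2b′`.  The proof is ★ F4b-1's verbatim with the two `choose` steps replaced by the hypotheses `hsup`, `hinv`.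

## Main statement
* `setIntegral_farShell_eq_zero_of_supply` — the far shells of `t ↦ f_s(w_Δ n(t)) ψ_v(−τ(tr(β t)))` over `Skew` vanish beyond the explicit threshold.

## References
* [Casselman1980] W. Casselman, Compositio Math. 40 (1980), §3.   * [KudlaRallis1994] S. Kudla, S. Rallis, Ann. of Math. 140 (1994), §2.
* [Shimura1997] G. Shimura, CBMS 93 (1997), §18–§19 (local densities at unramified places).
-/

set_option autoImplicit false
-- the mandated namespace repeats the single-problem summit's segment (`HodgeConjecture.HodgeConjecture`)
set_option linter.dupNamespace false

noncomputable section

open scoped NNReal ENNReal Matrix Topology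
open NumberField IsDedekindDomain Matrix MeasureTheory Set Filter
open Literature.NumberTheory.Automorphic Literature.NumberTheory.Automorphic.UnitaryGroup
open Literature.NumberTheory.GelbartRogawski1991.AdaptedBlocks
open Literature.NumberTheory.GelbartRogawski1991.UnitaryDualPair.LocalSplitting
open Literature.NumberTheory.K2Lit.LocalSiegelDoubled
open Summit.HodgeConjecture.HodgeConjecture.Cruxes.HLiu418.K2LiuSiegelLeviWeylAlgebra
open Summit.HodgeConjecture.HodgeConjecture.Cruxes.HLiu418.K2LiuShellVanishingByAveraging
open Summit.HodgeConjecture.HodgeConjecture.Cruxes.HLiu418.K2LiuBadPlaceWhittakerShells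
open Summit.HodgeConjecture.HodgeConjecture.Cruxes.HLiu418.K2LiuLocalLeviSupply
open Summit.HodgeConjecture.HodgeConjecture.Cruxes.HLiu418.K2LiuLocalRingValuationBalls
open Summit.HodgeConjecture.HodgeConjecture.Cruxes.HLiu418.K2LiuWhittakerCharacterMoves
open Summit.HodgeConjecture.HodgeConjecture.Cruxes.HLiu418.K2LiuBadPlaceWhittakerFarShells

namespace Summit.HodgeConjecture.HodgeConjecture.Cruxes.HLiu418.K2LiuGoodPlaceWhittakerFarShells

variable (F : Type) [Field F] [NumberField F] (E : Type) [Field E] [NumberField E] [Algebra F E]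
  [Algebra.IsQuadraticExtension F E] (c : E ≃ₐ[F] E)
  {δ : E} (hcδ : c δ = -δ) (hδ : δ ≠ 0) {dd : F} (hd : δ * δ = algebraMap F E dd)
  (v : HeightOneSpectrum (𝓞 F)) (n : ℕ) {T₀ : Matrix (Fin n) (Fin n) F} (hT₀ : T₀.IsSymm) (hT₀d : IsUnit T₀.det)
  {JD : Matrix (Fin (n + n)) (Fin (n + n)) E} (hJD : JD = (gramD F n T₀).map (algebraMap F E))
  {π : v.adicCompletion F} (hπ : Valued.v π = WithZero.exp (-1 : ℤ))

include hcδ hδ hd hT₀ hT₀d hJD hπ in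
/-- **FAR SHELLS VANISH BEYOND AN EXPLICIT THRESHOLD** (Karel's lemma with the Levi supply hypothesised at radius `jS` and inverse integrality at
radius `jI`; data as in ★ F4b-1).  For every `T`-skew `β` with `β β⁻ = 1`, `β ∈ ball(−b)`, `β⁻ ∈ ball(−b′)` (`0 ≤ b, b′`, `2b_T ≤ b`), every
`k ≥ |jS| + |jI| + |d| + 2|c_ε| + 2|c₂| + 2 + 4b + 2b′` and every `s`:  `∫_{B(−k) ∖ B(−k+1)} f s (w_Δ n(t)) · ψ_v(−τ(tr(β t))) dμ(t) = 0`.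
[cite: Casselman1980, §3] [cite: KudlaRallis1994, §2] [cite: Shimura1997, §18] -/
theorem setIntegral_farShell_eq_zero_of_supply
    (S : AddSubgroup (Matrix (Fin n) (Fin n) (LocalRing E v)))
    (hS : ∀ t, t ∈ S ↔ (t.map (conjLocal E c v))ᵀ * gramS F E v n T₀ + gramS F E v n T₀ * t = 0)
    [MeasurableSpace S] [BorelSpace S] [LocallyCompactSpace S] (μ : Measure S) [μ.IsAddHaarMeasure] [μ.Regular]
    [MeasurableSpace (v.adicCompletion F)] [BorelSpace (v.adicCompletion F)] (μF : Measure (v.adicCompletion F)) [μF.IsAddHaarMeasure]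
    -- the section family, its smoothness group, the characters `χ_w`
    {χv : ∀ w : PlacesOver E v, (w.1.adicCompletion E)ˣ →* ℂˣ} {U : Subgroup (UnitaryGroup.localPi E c (n + n) JD v)}
    {f : ℂ → UnitaryGroup.localPi E c (n + n) JD v → ℂ} (hf : ∀ s, IsLocalSiegelSection F E c hcδ hδ hd v n hT₀ hJD χv s (f s))
    (hfU : ∀ s g k, k ∈ U → f s (g * k) = f s g)
    (hφm : ∀ s, Measurable fun t : S => f s (weylDelta F E c v n hJD * nElem F E c v n hJD t.1 ((hS t.1).1 t.2)))
    (hφC : ∀ s (k : ℤ), ∃ C : ℝ, ∀ t : S, (∀ i j (w : PlacesOver E v), Valued.v (t.1 i j w) ≤ Valued.v (toPlace v w π) ^ (-k)) →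
      ‖f s (weylDelta F E c v n hJD * nElem F E c v n hJD t.1 ((hS t.1).1 t.2))‖ ≤ C)
    -- the additive character and the trace-type functional
    {ψ : AddChar (v.adicCompletion F) Circle} (hψ : Continuous ψ) {d : ℤ} (hdψ : ψ.HasConductorExp d)
    {τ : LocalRing E v → v.adicCompletion F} (hτ : ∀ r, toLocalRing E v (τ r) = r + conjLocal E c v r) (hτadd : ∀ r s, τ (r + s) = τ r + τ s)
    (hτs : ∀ (z : v.adicCompletion F) (r : LocalRing E v), τ (toLocalRing E v z * r) = z * τ r) (hτc : Continuous τ)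
    -- the anti-invariant integral element and the constants
    {ε : LocalRing E v} (hεσ : conjLocal E c v ε = -ε) (hεint : ∀ w : PlacesOver E v, Valued.v (ε w) ≤ 1) {cε c₂ bT : ℤ}
    (hε : ∀ w : PlacesOver E v, Valued.v (toPlace v w π) ^ cε ≤ Valued.v ((2 * ε) w))
    (h2 : ∀ w : PlacesOver E v, Valued.v (toPlace v w π) ^ c₂ ≤ Valued.v ((2 : LocalRing E v) w))
    (hTb : ∀ i j (w : PlacesOver E v), Valued.v (gramS F E v n T₀ i j w) ≤ Valued.v (toPlace v w π) ^ (-bT))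
    (hTib : ∀ i j (w : PlacesOver E v), Valued.v ((gramS F E v n T₀)⁻¹ i j w) ≤ Valued.v (toPlace v w π) ^ (-bT)) (hbT : 0 ≤ bT)
    -- THE EXPLICIT SUPPLY: Levi elements at radius `jS`, inverse integrality at radius `jI`
    {jS jI : ℤ}
    (hsup : ∀ u : Matrix (Fin n) (Fin n) (LocalRing E v), (∀ a b (w : PlacesOver E v), Valued.v (u a b w) ≤ Valued.v (toPlace v w π) ^ (0 : ℤ)) →
      ∀ z ∈ primePowBall (v.adicCompletion F) jS, ∃ q ∈ U,
        blkC (matA F E c v n q) = 0 ∧ blkB (matA F E c v n q) = 0 ∧ blkA (matA F E c v n q) = 1 + toLocalRing E v z • u ∧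
        (blkD (matA F E c v n q))⁻¹ = 1 + toLocalRing E v z • ((gramS F E v n T₀)⁻¹ * (u.map (conjLocal E c v))ᵀ * gramS F E v n T₀) ∧
        chiDet F E c v n χv (weylDelta F E c v n hJD * q * weylDelta F E c v n hJD) = 1 ∧
        absDetDelta F E c v n (weylDelta F E c v n hJD * q * weylDelta F E c v n hJD) = 1)
    (hinv : ∀ u : Matrix (Fin n) (Fin n) (LocalRing E v), (∀ a b (w : PlacesOver E v), Valued.v (u a b w) ≤ Valued.v (toPlace v w π) ^ (-(2 * bT))) →
      ∀ z ∈ primePowBall (v.adicCompletion F) jI,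
        ∀ a b (w : PlacesOver E v), Valued.v ((1 + toLocalRing E v z • u)⁻¹ a b w) ≤ Valued.v (toPlace v w π) ^ (0 : ℤ))
    -- lattice facts (★ F3b by shape)
    (hBm : ∀ a : ℤ, MeasurableSet {t : S | ∀ i j (w : PlacesOver E v), Valued.v (t.1 i j w) ≤ Valued.v (toPlace v w π) ^ a})
    (hBfin : ∀ a : ℤ, μ {t : S | ∀ i j (w : PlacesOver E v), Valued.v (t.1 i j w) ≤ Valued.v (toPlace v w π) ^ a} ≠ ∞)
    (hB0 : μ {t : S | ∀ i j (w : PlacesOver E v), Valued.v (t.1 i j w) ≤ Valued.v (toPlace v w π) ^ (0 : ℤ)} ≠ 0)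
    (hpre : ∀ (L : S ≃ₜ+ S) (A D' A' D'' : Matrix (Fin n) (Fin n) (LocalRing E v)), (∀ t : S, (L t).1 = A * t.1 * D') →
      (∀ t : S, (L.symm t).1 = A' * t.1 * D'') →
      (∀ i j (w : PlacesOver E v), Valued.v (A i j w) ≤ Valued.v (toPlace v w π) ^ (0 : ℤ)) →
      (∀ i j (w : PlacesOver E v), Valued.v (D' i j w) ≤ Valued.v (toPlace v w π) ^ (0 : ℤ)) →
      (∀ i j (w : PlacesOver E v), Valued.v (A' i j w) ≤ Valued.v (toPlace v w π) ^ (0 : ℤ)) →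
      (∀ i j (w : PlacesOver E v), Valued.v (D'' i j w) ≤ Valued.v (toPlace v w π) ^ (0 : ℤ)) →
      ∀ a : ℤ, L ⁻¹' {t : S | ∀ i j (w : PlacesOver E v), Valued.v (t.1 i j w) ≤ Valued.v (toPlace v w π) ^ a} =
        {t : S | ∀ i j (w : PlacesOver E v), Valued.v (t.1 i j w) ≤ Valued.v (toPlace v w π) ^ a}) :
    ∀ (b b' : ℤ) (β βinv : Matrix (Fin n) (Fin n) (LocalRing E v)), 0 ≤ b → 0 ≤ b' → 2 * bT ≤ b →
      (β.map (conjLocal E c v))ᵀ * gramS F E v n T₀ + gramS F E v n T₀ * β = 0 → β * βinv = 1 →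
      (∀ i j (w : PlacesOver E v), Valued.v (β i j w) ≤ Valued.v (toPlace v w π) ^ (-b)) →
      (∀ i j (w : PlacesOver E v), Valued.v (βinv i j w) ≤ Valued.v (toPlace v w π) ^ (-b')) →
      ∀ k : ℤ, |jS| + |jI| + |d| + 2 * |cε| + 2 * |c₂| + 2 + 4 * b + 2 * b' ≤ k → ∀ s : ℂ,
        ∫ t in {t : S | ∀ i j (w : PlacesOver E v), Valued.v (t.1 i j w) ≤ Valued.v (toPlace v w π) ^ (-k)} \
            {t : S | ∀ i j (w : PlacesOver E v), Valued.v (t.1 i j w) ≤ Valued.v (toPlace v w π) ^ (-k + 1)},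
          f s (weylDelta F E c v n hJD * nElem F E c v n hJD t.1 ((hS t.1).1 t.2)) * ((ψ (-τ (Matrix.trace (β * t.1))) : Circle) : ℂ) ∂μ = 0 := by
  classical
  -- abbreviations
  set T : Matrix (Fin n) (Fin n) (LocalRing E v) := gramS F E v n T₀ with hTdef
  have hT : IsUnit T.det := isUnit_det_gramS' F E v n hT₀d
  have hTt : Tᵀ = T := gramS_transpose F E v n hT₀
  -- the directions `u i` and their Levi twists `u′ i`
  let ι := (Fin n × Fin n) × Bool
  let uu : ι → Matrix (Fin n) (Fin n) (LocalRing E v) := fun i => Matrix.single i.1.1 i.1.2 (if i.2 then ε else 1)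
  let uu' : ι → Matrix (Fin n) (Fin n) (LocalRing E v) := fun i => T⁻¹ * ((uu i).map (conjLocal E c v))ᵀ * T
  have hesc : ∀ bb : Bool, ∀ w : PlacesOver E v, Valued.v ((if bb then ε else (1 : LocalRing E v)) w) ≤ 1 := by
    intro bb w; cases bb
    · simp only [Bool.false_eq_true, ↓reduceIte, Pi.one_apply, map_one, le_refl]
    · exact hεint w
  have huu0 : ∀ i, ∀ a b (w : PlacesOver E v), Valued.v (uu i a b w) ≤ Valued.v (toPlace v w π) ^ (0 : ℤ) := fun i =>
    mball_single F E v n (hesc i.2) i.1.1 i.1.2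
  have huu' : ∀ i, ∀ a b (w : PlacesOver E v), Valued.v (uu' i a b w) ≤ Valued.v (toPlace v w π) ^ (-(2 * bT)) := by
    intro i
    have h := mball_mul F E v hπ (mball_mul F E v hπ hTib (mball_conjTranspose F E c v (huu0 i))) hTb
    intro a b w; rw [show -(2 * bT) = -bT + 0 + -bT by ring]; exact h a b w
  intro b b' β βinv hb hb' hbTb hβskew hββ hβ hβinv k hk s
  -- the averaging radius
  set j : ℤ := d + k - 1 - cε - c₂ - b' with hjdef
  have hf3 := abs_nonneg d
  have hf4 := abs_nonneg cε
  have hf5 := abs_nonneg c₂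
  have hfS0 := abs_nonneg jS
  have hfI0 := abs_nonneg jI
  have hf6 := le_abs_self d
  have hf7 := neg_abs_le d
  have hf8 := le_abs_self cε
  have hf9 := le_abs_self c₂
  have hfS := le_abs_self jS
  have hfI := le_abs_self jI
  have hJS : jS ≤ j := by omega
  have hJI : jI ≤ j := by omega
  have hj0 : 0 ≤ j := by omega
  have hbj : b ≤ j := by omega
  have h2j : k + 4 * b + d ≤ 2 * j := by omega
  have hb2 : ∀ i, ∀ a b₁ (w : PlacesOver E v), Valued.v (uu i a b₁ w) ≤ Valued.v (toPlace v w π) ^ (-b) := fun i =>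
    mball_antitone F E v hπ (by omega) (huu0 i)
  have hb2' : ∀ i, ∀ a b₁ (w : PlacesOver E v), Valued.v (uu' i a b₁ w) ≤ Valued.v (toPlace v w π) ^ (-b) := fun i =>
    mball_antitone F E v hπ (by omega) (huu' i)
  -- (3) the moves: Levi elements `q i z` and conjugations `L i z`, with their properties, for `z ∈ 𝔭^j`
  have hmoves : ∀ (i : ι) (z : v.adicCompletion F), ∃ (q : UnitaryGroup.localPi E c (n + n) JD v) (L : S ≃ₜ+ S),
      z ∈ primePowBall (v.adicCompletion F) j →
        q ∈ U ∧ blkC (matA F E c v n q) = 0 ∧ blkB (matA F E c v n q) = 0 ∧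
        chiDet F E c v n χv (weylDelta F E c v n hJD * q * weylDelta F E c v n hJD) = 1 ∧
        absDetDelta F E c v n (weylDelta F E c v n hJD * q * weylDelta F E c v n hJD) = 1 ∧
        (∀ t : S, (L t).1 = blkA (matA F E c v n q) * t.1 * (blkD (matA F E c v n q))⁻¹) ∧
        blkA (matA F E c v n q) = 1 + toLocalRing E v z • uu i ∧ (blkD (matA F E c v n q))⁻¹ = 1 + toLocalRing E v z • uu' i ∧
        (∀ a : ℤ, L ⁻¹' {t : S | ∀ i j (w : PlacesOver E v), Valued.v (t.1 i j w) ≤ Valued.v (toPlace v w π) ^ a} =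
          {t : S | ∀ i j (w : PlacesOver E v), Valued.v (t.1 i j w) ≤ Valued.v (toPlace v w π) ^ a}) := by
    intro i z
    by_cases hz : z ∈ primePowBall (v.adicCompletion F) j
    · obtain ⟨q, hqU, hC, hB, hA, hDinv, hχ, habs⟩ := hsup (uu i) (huu0 i) z (primePowBall_antitone hJS hz)
      have hqS : IsSiegelDelta F E c hcδ hδ hd v n hT₀ hJD q := (isSiegelDelta_iff_blkC_eq_zero F E c hcδ hδ hd v n hT₀ hJD q).2 hC
      obtain ⟨L, hL⟩ := exists_continuousAddEquiv_levi_conj F E c hcδ hδ hd v n hT₀ hJD S hS hqS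
      refine ⟨q, L, fun _ => ⟨hqU, hC, hB, hχ, habs, hL, hA, hDinv, ?_⟩⟩
      -- lattice invariance: the four blocks `A`, `D⁻¹`, `A⁻¹`, `D` are integral
      obtain ⟨hAu, hDu⟩ := isUnit_det_blkA_blkD F E c v n hC
      have hz0 : z ∈ primePowBall (v.adicCompletion F) 0 := primePowBall_antitone hj0 hz
      have hAint : ∀ a b₁ (w : PlacesOver E v), Valued.v (blkA (matA F E c v n q) a b₁ w) ≤ Valued.v (toPlace v w π) ^ (0 : ℤ) := by
        rw [hA]
        have h := mball_add F E v (mball_one F E v (m := Fin n) (π := π))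
          (mball_antitone F E v hπ (a := 0) (b := 0 + 0) (by omega) (mball_smul F E v hπ hz0 (huu0 i)))
        exact h
      have hDinvint : ∀ a b₁ (w : PlacesOver E v), Valued.v ((blkD (matA F E c v n q))⁻¹ a b₁ w) ≤ Valued.v (toPlace v w π) ^ (0 : ℤ) := by
        rw [hDinv]
        have hzb : z ∈ primePowBall (v.adicCompletion F) (2 * bT) := primePowBall_antitone (by omega) hz
        have h := mball_add F E v (mball_one F E v (m := Fin n) (π := π))
          (mball_antitone F E v hπ (a := 0) (b := 2 * bT + -(2 * bT)) (by omega) (mball_smul F E v hπ hzb (huu' i)))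
        exact h
      have hAinvint := hinv (uu i) (mball_antitone F E v hπ (by omega) (huu0 i)) z (primePowBall_antitone hJI hz)
      have hDint := hinv (uu' i) (huu' i) z (primePowBall_antitone hJI hz)
      rw [← hA] at hAinvint
      rw [← hDinv, Matrix.nonsing_inv_nonsing_inv _ hDu] at hDint
      have hsymm : ∀ t : S, (L.symm t).1 = (blkA (matA F E c v n q))⁻¹ * t.1 * blkD (matA F E c v n q) :=
        symm_apply_eq_of_apply_eq F E v n L hL (Matrix.nonsing_inv_mul _ hAu) (Matrix.nonsing_inv_mul _ hDu)
      exact hpre L _ _ _ _ hL hsymm hAint hDinvint hAinvint hDint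
    · exact ⟨1, ContinuousAddEquiv.refl S, fun h => absurd h hz⟩
  choose q L hqL using hmoves
  -- (4) feed ★ F4a
  obtain ⟨C, hC⟩ := hφC s k
  have hχcont : Continuous fun t : S => ((ψ (-τ (Matrix.trace (β * t.1))) : Circle) : ℂ) :=
    continuous_subtype_val.comp (hψ.comp (hτc.comp (continuous_const.matrix_mul continuous_subtype_val).matrix_trace).neg)
  have hcc : ∀ i : ι, Continuous fun t : S => -τ (Matrix.trace (β * (uu i * t.1 + t.1 * uu' i))) := fun i =>
    (hτc.comp (continuous_const.matrix_mul ((continuous_const.matrix_mul continuous_subtype_val).add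
      (continuous_subtype_val.matrix_mul continuous_const))).matrix_trace).neg
  have hprops := fun (i : ι) (z : v.adicCompletion F) (hz : z ∈ primePowBall (v.adicCompletion F) j) => hqL i z hz
  refine setIntegral_shell_eq_zero_of_levi F E c hcδ hδ hd v n hT₀ hJD S hS μ (hf s) (hfU s) (hφm s)
    (χ := fun t : S => ((ψ (-τ (Matrix.trace (β * t.1))) : Circle) : ℂ)) hχcont.measurable (fun t => by rw [Circle.norm_coe])
    μF hψ hdψ j ((hBm (-k)).diff (hBm (-k + 1))) (((measure_mono Set.sdiff_subset).trans_lt (lt_top_iff_ne_top.2 (hBfin (-k)))).ne) hB0 (hBfin 0)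
    (C := C) (fun t ht => hC t ht.1) (Finset.univ : Finset ι) q L (fun i t => -τ (Matrix.trace (β * (uu i * t.1 + t.1 * uu' i))))
    (fun i _ => (hcc i).measurable)
    (fun i _ z hz => (hprops i z hz).1) (fun i _ z hz => (hprops i z hz).2.1) (fun i _ z hz => (hprops i z hz).2.2.1)
    (fun i _ z hz => (hprops i z hz).2.2.2.1) (fun i _ z hz => (hprops i z hz).2.2.2.2.1) (fun i _ z hz => (hprops i z hz).2.2.2.2.2.1)
    (fun i _ z hz => (hprops i z hz).2.2.2.2.2.2.2.2 0) (fun i _ z hz => ?_) (fun i _ z hz t ht => ?_) (fun i _ i' _ z hz t ht => ?_)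
    (fun t ht => ?_)
  · -- the shell is preserved
    rw [Set.preimage_sdiff, (hprops i z hz).2.2.2.2.2.2.2.2 (-k), (hprops i z hz).2.2.2.2.2.2.2.2 (-k + 1)]
  · -- the character factorisation on the shell
    obtain ⟨-, -, -, -, -, hLf, hA, hDinv, -⟩ := hprops i z hz
    show ((ψ (-τ (Matrix.trace (β * (L i z t).1))) : Circle) : ℂ) = _
    rw [hLf t, hA, hDinv, whittakerChar_levi_conj F E v ψ hτadd hτs β (uu i) (uu' i) t.1 z,
      addChar_quadratic_term_eq_one F E c v hπ hdψ hτ hb h2j hβ (hb2 i) (hb2' i) ht.1 hz, mul_one]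
  · -- the boxes are permuted
    obtain ⟨-, -, -, -, -, hLf, hA, hDinv, -⟩ := hprops i' z hz
    have hsub := linear_coeff_sub_mem F E c v hπ hτ hτadd hτs hb hbj h2j (u := uu i) (u' := uu' i) (u₁ := uu i') (u₁' := uu' i') hβ
      (hb2 i) (hb2' i) (hb2 i') (hb2' i') ht.1 hz
    show -τ (Matrix.trace (β * (uu i * (L i' z t).1 + (L i' z t).1 * uu' i))) ∈ primePowBall (v.adicCompletion F) (d - j) ↔ _
    rw [hLf t, hA, hDinv]
    exact neg_mem_primePowBall_iff_of_sub_mem F v hsub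
  · -- the covering: a point of the shell has a coefficient outside `𝔭^{d−j}`
    by_contra hall
    push Not at hall
    have hcoef : ∀ a b₁ : Fin n, ∀ e ∈ ({1, ε} : Set (LocalRing E v)),
        τ (Matrix.trace (β * (Matrix.single a b₁ e * t.1 + t.1 * (T⁻¹ * ((Matrix.single a b₁ e).map (conjLocal E c v))ᵀ * T)))) ∈
          primePowBall (v.adicCompletion F) (d - j) := by
      intro a b₁ e he
      rcases he with rfl | rfl
      · have h' := neg_mem_primePowBall (hall ((a, b₁), false) (Finset.mem_univ _))
        rw [neg_neg] at h'
        exact h'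
      · have h' := neg_mem_primePowBall (hall ((a, b₁), true) (Finset.mem_univ _))
        rw [neg_neg] at h'
        exact h'
    have hball := mball_of_forall_coeff_mem F E c v hπ hcδ hδ hτ hτadd hT hTt hεσ hεint hε h2 hββ hβinv hβskew ((hS t.1).1 t.2) hcoef
    apply ht.2
    intro i j' w
    have h := hball i j' w
    rwa [show d - j - cε - c₂ - b' = -k + 1 by omega] at h


end Summit.HodgeConjecture.HodgeConjecture.Cruxes.HLiu418.K2LiuGoodPlaceWhittakerFarShells

end
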